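import Summits.QuantumFields.BalabanUV.Beta.CompositeMixedTable
import Summits.QuantumFields.BalabanUV.Beta.CompositeVertexWardRootedTwo

/-!
# `BalabanUV.Beta.CompositeMixedWardRootedDiv` — row D1 ∕ (C1), PART 110a: THE BACKGROUND DIVERGENCE OF THE FIVE SUMMANDS OF THE COMPOSITE MIXED KERNEL's
# CHAIN RULE (generic bricks; the transported legs closed by PART 105a's window laws, the top mixed brick by its own window law `h𝓉W`)

HONEST DEPENDENCY (page 1, mandatory): continuum YM on T⁴ ⇐ BetaPertH ∧ nine spine estimates (0/9 proved); BetaPertH ⇐ (D1) ∧ (D4) ∧ CAP+tail;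
G-an2-4 gates asym, D1 and NE2/3/4.  HONEST FRAMING (cell contract, verbatim): «discharging `BetaPertH` makes Bałaban's UV stability UNCONDITIONAL —
a real constructive-QFT result; it is NOT the continuum limit and NOT the Clay problem.»  ABSOLUTE RULE (cell charter, verbatim): «No internally-minted
statement may enter as a cited fact. Every hypothesis is either kernel-proved in this package or a verbatim quotation of a PUBLISHED theorem with page
reference. The manuscript(s) under audit are NOT citable for their own disputed steps — they are the thing under adjudication; programme-internal
(2001/route/tribunal) claims are never citable.»

WHY (row-D1 owner an2 gen 86, journal [AN2-G86-W-5]: provisional FINDING AN2-86-2).  The (W)_j letter of the `hW𝒯 j` END asks of the composite MIXED table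
(`CompositeMixedTable.compMixKer ∕ compMixFF`, F6-series) the letter `hM₂` of an2 g29's member-0 machinery with a row-parity-ODD remainder; at j = 0 it follows
from an2 g21's SITE law `MixedWardSiteLaw.mixKerAt_siteWard` (`Σ_κ (t(κ,u−e_κ;f,f′) − t(κ,u;f,f′)) = 2·h(f,f′)·([u = L•y+ρ] − [u = f.2])`, NOT symmetric in
`f, f′`).  This file computes, for ANY bricks `(ℓ, 𝓋, 𝒽, 𝓉)` obeying the window laws `hℓW`, `h𝓋W` (PART 105a) and **`h𝓉W`** (the integrated shape of that site
law), the divergence in the BACKGROUND slot (finest site `z`) of each of the five summands of the top-peel `compMixKer_succ` at depth `m+1`, with the gauge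
generator read through the depth-`m` composed root `G_m^z(x) := [L^m•x + R m = z]`:
* `div_mixTop` (summand 1, the top mixed brick along three transported bonds): `Σ_{b₁,b₂} ℓ̂(f;b₁) ℓ̂(f′;b₂) · 2𝒽(b₁,b₂)(G(L•y+ρ m) − G(b₁.2))` (`compLinKer_div` + `h𝓉W`);
* `div_hessLeft` ∕ `div_hessRight` (summands 2, 3, the top Hessian brick with the depth-`m` composite vertex in one fluctuation slot):
  `Σ ℓ̂(f;b₁) ℓ̂(f′;b₂) · (G(b₁.2) − [f.2 = z]) 𝒽(b₁,b₂)`, resp. `(G(b₂.2) − [f′.2 = z])` (`compVHKer_div_right`);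
* `div_vertHess` (summand 4, the top vertex brick over the composite Hessian): `Σ_{b₁} Ĥ_m(b₁;f,f′) · (G(L•y+ρ m) − G(b₁.2)) ℓ(b₁)` (`compLinKer_div` + `h𝓋W`);
* `div_linMixed` (summand 5, the top linear brick over the depth-`m` composite mixed kernel): the divergence commuted inside (for the induction of PART 110b).
PART 110b (`CompositeMixedWardRooted`) assembles them: the `[· = z]` legs and the `G(b_i.2)` of summands 2∕3 CANCEL IDENTICALLY under `f ↔ f′`, summand 4 cancels by
antisymmetry, and the SYMMETRISED composite mixed law closes by induction in «HG form» (generator at the Hessian brick's own-level rooted legs).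

WHAT: [folklore] finite-sum bookkeeping BY NAME over an2's `compLinKer ∕ compVHKer ∕ compMixKer`; no `def`, no `def … : Prop`, nothing cited, 0 sorry.  Nothing of
Bałaban's asserted, valued or discharged; 0 estimates; 0∕4 row-D1 binders; (W)_j NOT claimed; NOT (C1), NOT D1, NEVER «G-an2-4 closed», NOT BetaPertH, NOT continuum,
NOT Clay.  Row D1 ∕ (C1) OWNER «beta-an2», gen 86, 2026-08-30.  No existing file touched.
-/

noncomputable section

open Finset
open scoped BigOperators
open Literature.MathematicalPhysics.QuantumFieldTheory.Balaban1983to89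
open Literature.MathematicalPhysics.QuantumFieldTheory.Balaban1983to89.Beta
open AffineAveraging (Site box toSite unitVec)
open AveragingHessianKernels (Bond Near)
open Summit.QuantumFields.BalabanUV.Beta.CompositeVertexKernelRec
open Summit.QuantumFields.BalabanUV.Beta.CompositeMixedTable (compMixKer)
open Summit.QuantumFields.BalabanUV.Beta.CompositeVertexWardRooted
open Summit.QuantumFields.BalabanUV.Beta.CompositeVertexWardRootedTwo (sum_pair_comm)

namespace Summit.QuantumFields.BalabanUV.Beta.CompositeMixedWardRootedDiv

variable {d : ℕ}

section Generic

variable {ℓ : ℕ → Fin (d + 1) → Site (d + 1) → Bond (d + 1) → ℝ}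
  {𝓋 𝒽 : ℕ → Fin (d + 1) → Site (d + 1) → Bond (d + 1) → Bond (d + 1) → ℝ}
  {𝓉 : ℕ → Fin (d + 1) → Site (d + 1) → Bond (d + 1) → Bond (d + 1) → Bond (d + 1) → ℝ} {L : ℕ}
  {ρ : ℕ → Site (d + 1)} {R : ℕ → Site (d + 1)}
  (hR0 : R 0 = 0) (hRs : ∀ m : ℕ, R (m + 1) = R m + ((L ^ m : ℕ) : ℤ) • ρ m)
  (hℓW : ∀ (k : ℕ) (μ : Fin (d + 1)) (y : Site (d + 1)) (G : Site (d + 1) → ℝ),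
    ∑ κ : Fin (d + 1), ∑ e ∈ offs L, ℓ k μ y (κ, (L : ℤ) • y + e) * (G ((L : ℤ) • y + e + unitVec κ) - G ((L : ℤ) • y + e)) =
      G ((L : ℤ) • y + ρ k + (L : ℤ) • unitVec μ) - G ((L : ℤ) • y + ρ k))
  (h𝓋W : ∀ (k : ℕ) (μ : Fin (d + 1)) (y : Site (d + 1)) (f : Bond (d + 1)) (G : Site (d + 1) → ℝ),
    ∑ κ : Fin (d + 1), ∑ e ∈ offs L, 𝓋 k μ y f (κ, (L : ℤ) • y + e) * (G ((L : ℤ) • y + e + unitVec κ) - G ((L : ℤ) • y + e)) =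
      (G ((L : ℤ) • y + ρ k) - G f.2) * ℓ k μ y f)
  (h𝓉W : ∀ (k : ℕ) (μ : Fin (d + 1)) (y : Site (d + 1)) (f f' : Bond (d + 1)) (G : Site (d + 1) → ℝ),
    ∑ κ : Fin (d + 1), ∑ e ∈ offs L, 𝓉 k μ y (κ, (L : ℤ) • y + e) f f' * (G ((L : ℤ) • y + e + unitVec κ) - G ((L : ℤ) • y + e)) =
      2 * 𝒽 k μ y f f' * (G ((L : ℤ) • y + ρ k) - G f.2))

include hR0 hRs hℓW h𝓉W in
/-- [folklore] **SUMMAND 1 — THE TOP MIXED BRICK ALONG THREE TRANSPORTED BONDS**: the background divergence hits the transport of the background bond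
(`compLinKer_div`), and the brick's own window law `h𝓉W` reads it as `2·𝒽(b₁,b₂)·(G(L•y + ρ m) − G(b₁.2))` against the two transported fluctuation legs. -/
theorem div_mixTop (m : ℕ) (μ : Fin (d + 1)) (y : Site (d + 1)) (f f' : Bond (d + 1)) (z : Site (d + 1)) :
    ∑ κ₀ : Fin (d + 1),
        ((∑ κ : Fin (d + 1), ∑ e ∈ offs L, ∑ κ₁ : Fin (d + 1), ∑ e₁ ∈ offs L, ∑ κ₂ : Fin (d + 1), ∑ e₂ ∈ offs L,
            𝓉 m μ y (κ, (L : ℤ) • y + e) (κ₁, (L : ℤ) • y + e₁) (κ₂, (L : ℤ) • y + e₂)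
              * compLinKer ℓ L m (κ₀, z - unitVec κ₀) (κ, (L : ℤ) • y + e) * compLinKer ℓ L m f (κ₁, (L : ℤ) • y + e₁)
              * compLinKer ℓ L m f' (κ₂, (L : ℤ) • y + e₂)) -
          (∑ κ : Fin (d + 1), ∑ e ∈ offs L, ∑ κ₁ : Fin (d + 1), ∑ e₁ ∈ offs L, ∑ κ₂ : Fin (d + 1), ∑ e₂ ∈ offs L,
            𝓉 m μ y (κ, (L : ℤ) • y + e) (κ₁, (L : ℤ) • y + e₁) (κ₂, (L : ℤ) • y + e₂)
              * compLinKer ℓ L m (κ₀, z) (κ, (L : ℤ) • y + e) * compLinKer ℓ L m f (κ₁, (L : ℤ) • y + e₁)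
              * compLinKer ℓ L m f' (κ₂, (L : ℤ) • y + e₂))) =
      ∑ κ₁ : Fin (d + 1), ∑ e₁ ∈ offs L, ∑ κ₂ : Fin (d + 1), ∑ e₂ ∈ offs L,
        compLinKer ℓ L m f (κ₁, (L : ℤ) • y + e₁) * compLinKer ℓ L m f' (κ₂, (L : ℤ) • y + e₂) *
          (2 * 𝒽 m μ y (κ₁, (L : ℤ) • y + e₁) (κ₂, (L : ℤ) • y + e₂) *
            ((if ((L ^ m : ℕ) : ℤ) • ((L : ℤ) • y + ρ m) + R m = z then (1 : ℝ) else 0) -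
              (if ((L ^ m : ℕ) : ℤ) • ((L : ℤ) • y + e₁) + R m = z then (1 : ℝ) else 0))) := by
  set G : Site (d + 1) → ℝ := fun x => if ((L ^ m : ℕ) : ℤ) • x + R m = z then (1 : ℝ) else 0 with hG
  have hLIN := compLinKer_div hR0 hRs hℓW (ℓ := ℓ)
  calc _ = ∑ κ₀ : Fin (d + 1), ∑ κ : Fin (d + 1), ∑ e ∈ offs L, ∑ κ₁ : Fin (d + 1), ∑ e₁ ∈ offs L, ∑ κ₂ : Fin (d + 1), ∑ e₂ ∈ offs L,
        𝓉 m μ y (κ, (L : ℤ) • y + e) (κ₁, (L : ℤ) • y + e₁) (κ₂, (L : ℤ) • y + e₂)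
          * compLinKer ℓ L m f (κ₁, (L : ℤ) • y + e₁) * compLinKer ℓ L m f' (κ₂, (L : ℤ) • y + e₂) *
          (compLinKer ℓ L m (κ₀, z - unitVec κ₀) (κ, (L : ℤ) • y + e) - compLinKer ℓ L m (κ₀, z) (κ, (L : ℤ) • y + e)) := by
        refine Finset.sum_congr rfl fun κ₀ _ => ?_
        simp only [← Finset.sum_sub_distrib]
        refine Finset.sum_congr rfl fun κ _ => Finset.sum_congr rfl fun e _ => Finset.sum_congr rfl fun κ₁ _ =>
          Finset.sum_congr rfl fun e₁ _ => Finset.sum_congr rfl fun κ₂ _ => Finset.sum_congr rfl fun e₂ _ => ?_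
        ring
    _ = ∑ κ : Fin (d + 1), ∑ e ∈ offs L, ∑ κ₁ : Fin (d + 1), ∑ e₁ ∈ offs L, ∑ κ₂ : Fin (d + 1), ∑ e₂ ∈ offs L, ∑ κ₀ : Fin (d + 1),
        𝓉 m μ y (κ, (L : ℤ) • y + e) (κ₁, (L : ℤ) • y + e₁) (κ₂, (L : ℤ) • y + e₂)
          * compLinKer ℓ L m f (κ₁, (L : ℤ) • y + e₁) * compLinKer ℓ L m f' (κ₂, (L : ℤ) • y + e₂) *
          (compLinKer ℓ L m (κ₀, z - unitVec κ₀) (κ, (L : ℤ) • y + e) - compLinKer ℓ L m (κ₀, z) (κ, (L : ℤ) • y + e)) := by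
        rw [Finset.sum_comm]
        refine Finset.sum_congr rfl fun κ _ => ?_
        rw [Finset.sum_comm]
        refine Finset.sum_congr rfl fun e _ => ?_
        rw [Finset.sum_comm]
        refine Finset.sum_congr rfl fun κ₁ _ => ?_
        rw [Finset.sum_comm]
        refine Finset.sum_congr rfl fun e₁ _ => ?_
        rw [Finset.sum_comm]
        refine Finset.sum_congr rfl fun κ₂ _ => ?_
        rw [Finset.sum_comm]
    _ = ∑ κ : Fin (d + 1), ∑ e ∈ offs L, ∑ κ₁ : Fin (d + 1), ∑ e₁ ∈ offs L, ∑ κ₂ : Fin (d + 1), ∑ e₂ ∈ offs L,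
        𝓉 m μ y (κ, (L : ℤ) • y + e) (κ₁, (L : ℤ) • y + e₁) (κ₂, (L : ℤ) • y + e₂)
          * compLinKer ℓ L m f (κ₁, (L : ℤ) • y + e₁) * compLinKer ℓ L m f' (κ₂, (L : ℤ) • y + e₂) *
          (G ((L : ℤ) • y + e + unitVec κ) - G ((L : ℤ) • y + e)) := by
        refine Finset.sum_congr rfl fun κ _ => Finset.sum_congr rfl fun e _ => Finset.sum_congr rfl fun κ₁ _ =>
          Finset.sum_congr rfl fun e₁ _ => Finset.sum_congr rfl fun κ₂ _ => Finset.sum_congr rfl fun e₂ _ => ?_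
        rw [← Finset.mul_sum, hLIN m (κ, (L : ℤ) • y + e) z]
    _ = ∑ κ₁ : Fin (d + 1), ∑ e₁ ∈ offs L, ∑ κ : Fin (d + 1), ∑ e ∈ offs L, ∑ κ₂ : Fin (d + 1), ∑ e₂ ∈ offs L,
        𝓉 m μ y (κ, (L : ℤ) • y + e) (κ₁, (L : ℤ) • y + e₁) (κ₂, (L : ℤ) • y + e₂)
          * compLinKer ℓ L m f (κ₁, (L : ℤ) • y + e₁) * compLinKer ℓ L m f' (κ₂, (L : ℤ) • y + e₂) *
          (G ((L : ℤ) • y + e + unitVec κ) - G ((L : ℤ) • y + e)) :=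
        sum_pair_comm L (fun κ e κ₁ e₁ => ∑ κ₂ : Fin (d + 1), ∑ e₂ ∈ offs L,
          𝓉 m μ y (κ, (L : ℤ) • y + e) (κ₁, (L : ℤ) • y + e₁) (κ₂, (L : ℤ) • y + e₂)
            * compLinKer ℓ L m f (κ₁, (L : ℤ) • y + e₁) * compLinKer ℓ L m f' (κ₂, (L : ℤ) • y + e₂) *
            (G ((L : ℤ) • y + e + unitVec κ) - G ((L : ℤ) • y + e)))
    _ = ∑ κ₁ : Fin (d + 1), ∑ e₁ ∈ offs L, ∑ κ₂ : Fin (d + 1), ∑ e₂ ∈ offs L, ∑ κ : Fin (d + 1), ∑ e ∈ offs L,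
        𝓉 m μ y (κ, (L : ℤ) • y + e) (κ₁, (L : ℤ) • y + e₁) (κ₂, (L : ℤ) • y + e₂)
          * compLinKer ℓ L m f (κ₁, (L : ℤ) • y + e₁) * compLinKer ℓ L m f' (κ₂, (L : ℤ) • y + e₂) *
          (G ((L : ℤ) • y + e + unitVec κ) - G ((L : ℤ) • y + e)) := by
        refine Finset.sum_congr rfl fun κ₁ _ => Finset.sum_congr rfl fun e₁ _ => ?_
        exact sum_pair_comm L (fun κ e κ₂ e₂ =>
          𝓉 m μ y (κ, (L : ℤ) • y + e) (κ₁, (L : ℤ) • y + e₁) (κ₂, (L : ℤ) • y + e₂)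
            * compLinKer ℓ L m f (κ₁, (L : ℤ) • y + e₁) * compLinKer ℓ L m f' (κ₂, (L : ℤ) • y + e₂) *
            (G ((L : ℤ) • y + e + unitVec κ) - G ((L : ℤ) • y + e)))
    _ = ∑ κ₁ : Fin (d + 1), ∑ e₁ ∈ offs L, ∑ κ₂ : Fin (d + 1), ∑ e₂ ∈ offs L,
        compLinKer ℓ L m f (κ₁, (L : ℤ) • y + e₁) * compLinKer ℓ L m f' (κ₂, (L : ℤ) • y + e₂) *
          ∑ κ : Fin (d + 1), ∑ e ∈ offs L, 𝓉 m μ y (κ, (L : ℤ) • y + e) (κ₁, (L : ℤ) • y + e₁) (κ₂, (L : ℤ) • y + e₂) *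
            (G ((L : ℤ) • y + e + unitVec κ) - G ((L : ℤ) • y + e)) := by
        refine Finset.sum_congr rfl fun κ₁ _ => Finset.sum_congr rfl fun e₁ _ => Finset.sum_congr rfl fun κ₂ _ => Finset.sum_congr rfl fun e₂ _ => ?_
        rw [Finset.mul_sum]
        refine Finset.sum_congr rfl fun κ _ => ?_
        rw [Finset.mul_sum]
        refine Finset.sum_congr rfl fun e _ => ?_
        ring
    _ = _ := by
        refine Finset.sum_congr rfl fun κ₁ _ => Finset.sum_congr rfl fun e₁ _ => Finset.sum_congr rfl fun κ₂ _ => Finset.sum_congr rfl fun e₂ _ => ?_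
        rw [h𝓉W m μ y (κ₁, (L : ℤ) • y + e₁) (κ₂, (L : ℤ) • y + e₂) G]

include hR0 hRs hℓW h𝓋W in
/-- [folklore] **SUMMAND 2 — THE TOP HESSIAN BRICK, DEPTH-`m` COMPOSITE VERTEX IN THE FIRST FLUCTUATION SLOT**: the background divergence hits the composite
vertex `V̂(b₁; f, ·)` (PART 105a `compVHKer_div_right`): `(G(b₁.2) − [f.2 = z]) · ℓ̂(f;b₁)`. -/
theorem div_hessLeft (m : ℕ) (μ : Fin (d + 1)) (y : Site (d + 1)) (f f' : Bond (d + 1)) (z : Site (d + 1)) :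
    ∑ κ₀ : Fin (d + 1),
        ((∑ κ₁ : Fin (d + 1), ∑ e₁ ∈ offs L, ∑ κ₂ : Fin (d + 1), ∑ e₂ ∈ offs L,
            𝒽 m μ y (κ₁, (L : ℤ) • y + e₁) (κ₂, (L : ℤ) • y + e₂)
              * compVHKer ℓ 𝓋 L m κ₁ ((L : ℤ) • y + e₁) f (κ₀, z - unitVec κ₀) * compLinKer ℓ L m f' (κ₂, (L : ℤ) • y + e₂)) -
          (∑ κ₁ : Fin (d + 1), ∑ e₁ ∈ offs L, ∑ κ₂ : Fin (d + 1), ∑ e₂ ∈ offs L,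
            𝒽 m μ y (κ₁, (L : ℤ) • y + e₁) (κ₂, (L : ℤ) • y + e₂)
              * compVHKer ℓ 𝓋 L m κ₁ ((L : ℤ) • y + e₁) f (κ₀, z) * compLinKer ℓ L m f' (κ₂, (L : ℤ) • y + e₂))) =
      ∑ κ₁ : Fin (d + 1), ∑ e₁ ∈ offs L, ∑ κ₂ : Fin (d + 1), ∑ e₂ ∈ offs L,
        compLinKer ℓ L m f (κ₁, (L : ℤ) • y + e₁) * compLinKer ℓ L m f' (κ₂, (L : ℤ) • y + e₂) *
          (((if ((L ^ m : ℕ) : ℤ) • ((L : ℤ) • y + e₁) + R m = z then (1 : ℝ) else 0) - (if f.2 = z then (1 : ℝ) else 0)) *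
            𝒽 m μ y (κ₁, (L : ℤ) • y + e₁) (κ₂, (L : ℤ) • y + e₂)) := by
  have hCL := compVHKer_div_right hR0 hRs hℓW h𝓋W (𝓋 := 𝓋)
  calc _ = ∑ κ₀ : Fin (d + 1), ∑ κ₁ : Fin (d + 1), ∑ e₁ ∈ offs L, ∑ κ₂ : Fin (d + 1), ∑ e₂ ∈ offs L,
        𝒽 m μ y (κ₁, (L : ℤ) • y + e₁) (κ₂, (L : ℤ) • y + e₂) * compLinKer ℓ L m f' (κ₂, (L : ℤ) • y + e₂) *
          (compVHKer ℓ 𝓋 L m κ₁ ((L : ℤ) • y + e₁) f (κ₀, z - unitVec κ₀) - compVHKer ℓ 𝓋 L m κ₁ ((L : ℤ) • y + e₁) f (κ₀, z)) := by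
        refine Finset.sum_congr rfl fun κ₀ _ => ?_
        simp only [← Finset.sum_sub_distrib]
        refine Finset.sum_congr rfl fun κ₁ _ => Finset.sum_congr rfl fun e₁ _ => Finset.sum_congr rfl fun κ₂ _ => Finset.sum_congr rfl fun e₂ _ => ?_
        ring
    _ = ∑ κ₁ : Fin (d + 1), ∑ e₁ ∈ offs L, ∑ κ₂ : Fin (d + 1), ∑ e₂ ∈ offs L, ∑ κ₀ : Fin (d + 1),
        𝒽 m μ y (κ₁, (L : ℤ) • y + e₁) (κ₂, (L : ℤ) • y + e₂) * compLinKer ℓ L m f' (κ₂, (L : ℤ) • y + e₂) *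
          (compVHKer ℓ 𝓋 L m κ₁ ((L : ℤ) • y + e₁) f (κ₀, z - unitVec κ₀) - compVHKer ℓ 𝓋 L m κ₁ ((L : ℤ) • y + e₁) f (κ₀, z)) := by
        rw [Finset.sum_comm]
        refine Finset.sum_congr rfl fun κ₁ _ => ?_
        rw [Finset.sum_comm]
        refine Finset.sum_congr rfl fun e₁ _ => ?_
        rw [Finset.sum_comm]
        refine Finset.sum_congr rfl fun κ₂ _ => ?_
        rw [Finset.sum_comm]
    _ = _ := by
        refine Finset.sum_congr rfl fun κ₁ _ => Finset.sum_congr rfl fun e₁ _ => Finset.sum_congr rfl fun κ₂ _ => Finset.sum_congr rfl fun e₂ _ => ?_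
        rw [← Finset.mul_sum, hCL m κ₁ ((L : ℤ) • y + e₁) f z]
        ring

include hR0 hRs hℓW h𝓋W in
/-- [folklore] **SUMMAND 3 — THE TOP HESSIAN BRICK, DEPTH-`m` COMPOSITE VERTEX IN THE SECOND FLUCTUATION SLOT**: `(G(b₂.2) − [f′.2 = z]) · ℓ̂(f′;b₂)`. -/
theorem div_hessRight (m : ℕ) (μ : Fin (d + 1)) (y : Site (d + 1)) (f f' : Bond (d + 1)) (z : Site (d + 1)) :
    ∑ κ₀ : Fin (d + 1),
        ((∑ κ₁ : Fin (d + 1), ∑ e₁ ∈ offs L, ∑ κ₂ : Fin (d + 1), ∑ e₂ ∈ offs L,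
            𝒽 m μ y (κ₁, (L : ℤ) • y + e₁) (κ₂, (L : ℤ) • y + e₂)
              * compLinKer ℓ L m f (κ₁, (L : ℤ) • y + e₁) * compVHKer ℓ 𝓋 L m κ₂ ((L : ℤ) • y + e₂) f' (κ₀, z - unitVec κ₀)) -
          (∑ κ₁ : Fin (d + 1), ∑ e₁ ∈ offs L, ∑ κ₂ : Fin (d + 1), ∑ e₂ ∈ offs L,
            𝒽 m μ y (κ₁, (L : ℤ) • y + e₁) (κ₂, (L : ℤ) • y + e₂)
              * compLinKer ℓ L m f (κ₁, (L : ℤ) • y + e₁) * compVHKer ℓ 𝓋 L m κ₂ ((L : ℤ) • y + e₂) f' (κ₀, z))) =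
      ∑ κ₁ : Fin (d + 1), ∑ e₁ ∈ offs L, ∑ κ₂ : Fin (d + 1), ∑ e₂ ∈ offs L,
        compLinKer ℓ L m f (κ₁, (L : ℤ) • y + e₁) * compLinKer ℓ L m f' (κ₂, (L : ℤ) • y + e₂) *
          (((if ((L ^ m : ℕ) : ℤ) • ((L : ℤ) • y + e₂) + R m = z then (1 : ℝ) else 0) - (if f'.2 = z then (1 : ℝ) else 0)) *
            𝒽 m μ y (κ₁, (L : ℤ) • y + e₁) (κ₂, (L : ℤ) • y + e₂)) := by
  have hCL := compVHKer_div_right hR0 hRs hℓW h𝓋W (𝓋 := 𝓋)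
  calc _ = ∑ κ₀ : Fin (d + 1), ∑ κ₁ : Fin (d + 1), ∑ e₁ ∈ offs L, ∑ κ₂ : Fin (d + 1), ∑ e₂ ∈ offs L,
        𝒽 m μ y (κ₁, (L : ℤ) • y + e₁) (κ₂, (L : ℤ) • y + e₂) * compLinKer ℓ L m f (κ₁, (L : ℤ) • y + e₁) *
          (compVHKer ℓ 𝓋 L m κ₂ ((L : ℤ) • y + e₂) f' (κ₀, z - unitVec κ₀) - compVHKer ℓ 𝓋 L m κ₂ ((L : ℤ) • y + e₂) f' (κ₀, z)) := by
        refine Finset.sum_congr rfl fun κ₀ _ => ?_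
        simp only [← Finset.sum_sub_distrib]
        refine Finset.sum_congr rfl fun κ₁ _ => Finset.sum_congr rfl fun e₁ _ => Finset.sum_congr rfl fun κ₂ _ => Finset.sum_congr rfl fun e₂ _ => ?_
        ring
    _ = ∑ κ₁ : Fin (d + 1), ∑ e₁ ∈ offs L, ∑ κ₂ : Fin (d + 1), ∑ e₂ ∈ offs L, ∑ κ₀ : Fin (d + 1),
        𝒽 m μ y (κ₁, (L : ℤ) • y + e₁) (κ₂, (L : ℤ) • y + e₂) * compLinKer ℓ L m f (κ₁, (L : ℤ) • y + e₁) *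
          (compVHKer ℓ 𝓋 L m κ₂ ((L : ℤ) • y + e₂) f' (κ₀, z - unitVec κ₀) - compVHKer ℓ 𝓋 L m κ₂ ((L : ℤ) • y + e₂) f' (κ₀, z)) := by
        rw [Finset.sum_comm]
        refine Finset.sum_congr rfl fun κ₁ _ => ?_
        rw [Finset.sum_comm]
        refine Finset.sum_congr rfl fun e₁ _ => ?_
        rw [Finset.sum_comm]
        refine Finset.sum_congr rfl fun κ₂ _ => ?_
        rw [Finset.sum_comm]
    _ = _ := by
        refine Finset.sum_congr rfl fun κ₁ _ => Finset.sum_congr rfl fun e₁ _ => Finset.sum_congr rfl fun κ₂ _ => Finset.sum_congr rfl fun e₂ _ => ?_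
        rw [← Finset.mul_sum, hCL m κ₂ ((L : ℤ) • y + e₂) f' z]
        ring

include hR0 hRs hℓW h𝓋W in
/-- [folklore] **SUMMAND 4 — THE TOP VERTEX BRICK OVER THE DEPTH-`m` COMPOSITE HESSIAN**: the background divergence hits the transport of the background bond in the
vertex brick's background slot (`compLinKer_div`, then `h𝓋W`): `Ĥ_m(b₁;f,f′) · (G(L•y + ρ m) − G(b₁.2)) · ℓ(b₁)`. -/
theorem div_vertHess (m : ℕ) (μ : Fin (d + 1)) (y : Site (d + 1)) (f f' : Bond (d + 1)) (z : Site (d + 1)) :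
    ∑ κ₀ : Fin (d + 1),
        ((∑ κ₁ : Fin (d + 1), ∑ e₁ ∈ offs L, ∑ κ : Fin (d + 1), ∑ e ∈ offs L,
            𝓋 m μ y (κ₁, (L : ℤ) • y + e₁) (κ, (L : ℤ) • y + e)
              * compVHKer ℓ 𝒽 L m κ₁ ((L : ℤ) • y + e₁) f f' * compLinKer ℓ L m (κ₀, z - unitVec κ₀) (κ, (L : ℤ) • y + e)) -
          (∑ κ₁ : Fin (d + 1), ∑ e₁ ∈ offs L, ∑ κ : Fin (d + 1), ∑ e ∈ offs L,
            𝓋 m μ y (κ₁, (L : ℤ) • y + e₁) (κ, (L : ℤ) • y + e)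
              * compVHKer ℓ 𝒽 L m κ₁ ((L : ℤ) • y + e₁) f f' * compLinKer ℓ L m (κ₀, z) (κ, (L : ℤ) • y + e))) =
      ∑ κ₁ : Fin (d + 1), ∑ e₁ ∈ offs L, compVHKer ℓ 𝒽 L m κ₁ ((L : ℤ) • y + e₁) f f' *
        (((if ((L ^ m : ℕ) : ℤ) • ((L : ℤ) • y + ρ m) + R m = z then (1 : ℝ) else 0) -
            (if ((L ^ m : ℕ) : ℤ) • ((L : ℤ) • y + e₁) + R m = z then (1 : ℝ) else 0)) * ℓ m μ y (κ₁, (L : ℤ) • y + e₁)) := by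
  set G : Site (d + 1) → ℝ := fun x => if ((L ^ m : ℕ) : ℤ) • x + R m = z then (1 : ℝ) else 0 with hG
  have hLIN := compLinKer_div hR0 hRs hℓW (ℓ := ℓ)
  calc _ = ∑ κ₀ : Fin (d + 1), ∑ κ₁ : Fin (d + 1), ∑ e₁ ∈ offs L, ∑ κ : Fin (d + 1), ∑ e ∈ offs L,
        compVHKer ℓ 𝒽 L m κ₁ ((L : ℤ) • y + e₁) f f' * 𝓋 m μ y (κ₁, (L : ℤ) • y + e₁) (κ, (L : ℤ) • y + e) *
          (compLinKer ℓ L m (κ₀, z - unitVec κ₀) (κ, (L : ℤ) • y + e) - compLinKer ℓ L m (κ₀, z) (κ, (L : ℤ) • y + e)) := by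
        refine Finset.sum_congr rfl fun κ₀ _ => ?_
        simp only [← Finset.sum_sub_distrib]
        refine Finset.sum_congr rfl fun κ₁ _ => Finset.sum_congr rfl fun e₁ _ => Finset.sum_congr rfl fun κ _ => Finset.sum_congr rfl fun e _ => ?_
        ring
    _ = ∑ κ₁ : Fin (d + 1), ∑ e₁ ∈ offs L, ∑ κ : Fin (d + 1), ∑ e ∈ offs L, ∑ κ₀ : Fin (d + 1),
        compVHKer ℓ 𝒽 L m κ₁ ((L : ℤ) • y + e₁) f f' * 𝓋 m μ y (κ₁, (L : ℤ) • y + e₁) (κ, (L : ℤ) • y + e) *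
          (compLinKer ℓ L m (κ₀, z - unitVec κ₀) (κ, (L : ℤ) • y + e) - compLinKer ℓ L m (κ₀, z) (κ, (L : ℤ) • y + e)) := by
        rw [Finset.sum_comm]
        refine Finset.sum_congr rfl fun κ₁ _ => ?_
        rw [Finset.sum_comm]
        refine Finset.sum_congr rfl fun e₁ _ => ?_
        rw [Finset.sum_comm]
        refine Finset.sum_congr rfl fun κ _ => ?_
        rw [Finset.sum_comm]
    _ = ∑ κ₁ : Fin (d + 1), ∑ e₁ ∈ offs L, compVHKer ℓ 𝒽 L m κ₁ ((L : ℤ) • y + e₁) f f' *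
        ∑ κ : Fin (d + 1), ∑ e ∈ offs L, 𝓋 m μ y (κ₁, (L : ℤ) • y + e₁) (κ, (L : ℤ) • y + e) *
          (G ((L : ℤ) • y + e + unitVec κ) - G ((L : ℤ) • y + e)) := by
        refine Finset.sum_congr rfl fun κ₁ _ => Finset.sum_congr rfl fun e₁ _ => ?_
        rw [Finset.mul_sum]
        refine Finset.sum_congr rfl fun κ _ => ?_
        rw [Finset.mul_sum]
        refine Finset.sum_congr rfl fun e _ => ?_
        rw [← Finset.mul_sum, hLIN m (κ, (L : ℤ) • y + e) z]
        ring
    _ = _ := by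
        refine Finset.sum_congr rfl fun κ₁ _ => Finset.sum_congr rfl fun e₁ _ => ?_
        rw [h𝓋W m μ y (κ₁, (L : ℤ) • y + e₁) G]

omit hR0 hRs hℓW h𝓋W h𝓉W in
/-- [folklore] **SUMMAND 5 — THE TOP LINEAR BRICK OVER THE DEPTH-`m` COMPOSITE MIXED KERNEL**: the background divergence commuted inside (the depth-`m` kernel's
own divergence is supplied by the induction of PART 110b). -/
theorem div_linMixed (m : ℕ) (μ : Fin (d + 1)) (y : Site (d + 1)) (f f' : Bond (d + 1)) (z : Site (d + 1)) :
    ∑ κ₀ : Fin (d + 1),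
        ((∑ κ : Fin (d + 1), ∑ e ∈ offs L, ℓ m μ y (κ, (L : ℤ) • y + e) * compMixKer ℓ 𝓋 𝒽 𝓉 L m κ ((L : ℤ) • y + e) (κ₀, z - unitVec κ₀) f f') -
          (∑ κ : Fin (d + 1), ∑ e ∈ offs L, ℓ m μ y (κ, (L : ℤ) • y + e) * compMixKer ℓ 𝓋 𝒽 𝓉 L m κ ((L : ℤ) • y + e) (κ₀, z) f f')) =
      ∑ κ : Fin (d + 1), ∑ e ∈ offs L, ℓ m μ y (κ, (L : ℤ) • y + e) *
        ∑ κ₀ : Fin (d + 1), (compMixKer ℓ 𝓋 𝒽 𝓉 L m κ ((L : ℤ) • y + e) (κ₀, z - unitVec κ₀) f f' -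
          compMixKer ℓ 𝓋 𝒽 𝓉 L m κ ((L : ℤ) • y + e) (κ₀, z) f f') := by
  calc _ = ∑ κ₀ : Fin (d + 1), ∑ κ : Fin (d + 1), ∑ e ∈ offs L, ℓ m μ y (κ, (L : ℤ) • y + e) *
        (compMixKer ℓ 𝓋 𝒽 𝓉 L m κ ((L : ℤ) • y + e) (κ₀, z - unitVec κ₀) f f' - compMixKer ℓ 𝓋 𝒽 𝓉 L m κ ((L : ℤ) • y + e) (κ₀, z) f f') := by
        refine Finset.sum_congr rfl fun κ₀ _ => ?_
        simp only [← Finset.sum_sub_distrib, ← mul_sub]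
    _ = ∑ κ : Fin (d + 1), ∑ e ∈ offs L, ∑ κ₀ : Fin (d + 1), ℓ m μ y (κ, (L : ℤ) • y + e) *
        (compMixKer ℓ 𝓋 𝒽 𝓉 L m κ ((L : ℤ) • y + e) (κ₀, z - unitVec κ₀) f f' - compMixKer ℓ 𝓋 𝒽 𝓉 L m κ ((L : ℤ) • y + e) (κ₀, z) f f') := by
        rw [Finset.sum_comm]
        refine Finset.sum_congr rfl fun κ _ => ?_
        rw [Finset.sum_comm]
    _ = _ := by
        refine Finset.sum_congr rfl fun κ _ => Finset.sum_congr rfl fun e _ => ?_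
        rw [Finset.mul_sum]

end Generic

end Summit.QuantumFields.BalabanUV.Beta.CompositeMixedWardRootedDiv

end
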